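import Literature.Analysis.FluidPDE.EnergySpaceTorusHilbertBasisProofs
import Literature.Analysis.UnboundedOperators.DiagonalOperatorCompact
import HarnessLib

/-!
# The Stokes resolvent `(1 + A)⁻¹` on the energy space of the flat torus

Topic `Literature/Analysis/FluidPDE`; companion of `StokesTorus.lean` (the Stokes operator
`A = Torus.stokesOperatorH d : H →ₗ.[ℝ] H` on the mean-zero solenoidal energy space
`H = Torus.energySpace d ⊂ L²(T^d; ℝ^d)`) and of `EnergySpaceTorusHilbertBasisProofs.lean`
(`exists_hilbertBasis_stokes_holds`: `A` is the maximal diagonal operator `b.diagonalPMap m` in a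
Hilbert basis `b` of Stokes modes, with symbol `0 < m i = 4π²|kᵢ|² → ∞`).

**Theorems** (no definitions, no named facts):

* `exists_resolvent_diagonalPMap` — for a Hilbert basis `b` of a real Hilbert space and a
  non-negative symbol `m` with `m i → ∞` along the cofinite filter, the bounded diagonal operator
  `R = b.diagonalCLM ((1 + m)⁻¹)` is an injective, self-adjoint, compact contraction which is a
  two-sided inverse of `1 + b.diagonalPMap m`: `R v ∈ D(diag m)` and `R v + diag(m) (R v) = v` for
  every `v`, and `R (v + diag(m) v) = v` on the domain (Reed–Simon I, §VIII.3 Proposition 1 and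
  Thm. VIII.2 (resolvents of self-adjoint multiplication operators); Halmos, *A Hilbert Space
  Problem Book*, Problems 61–63, 171 (diagonal operators: norm, adjoint, compactness));
* `Torus.exists_stokesResolvent` — the **Stokes resolvent** `(1 + A)⁻¹` on `H = Torus.energySpace d`:
  an injective self-adjoint compact contraction `R : H →L[ℝ] H` with `R v ∈ D(A)`,
  `R v + A (R v) = v` (`v ∈ H`) and `R (v + A v) = v` (`v ∈ D(A)`) (Constantin–Foias 1988, Ch. 4,
  (4.4)–(4.7), (4.11)–(4.13): `A` is positive self-adjoint with compact inverse, `A w_j = λ_j w_j`,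
  `λ_j → ∞`; Temam 1977, Ch. I §2.6).

The second is the first applied to the eigenbasis of `exists_hilbertBasis_stokes_holds`, after
rewriting `Torus.stokesOperatorH d = b.diagonalPMap m`.  It is the smoothing isomorphism
`H → D(A) = H ∩ H²` by which the Navier–Stokes semiflow is conjugated to a smooth semiflow on an
open subset of `H`.  Deliberately NOT here: a named `def` of the resolvent (the existential
statement is all that is consumed), the identification `D(A) = H ∩ H²`, resolvents `(λ + A)⁻¹`
for general `λ` (the proof is verbatim the same for `λ > 0`).

## References

* P. Constantin, C. Foias, *Navier–Stokes Equations* (Univ. Chicago Press, 1988), Ch. 4,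
  (4.4)–(4.7), (4.11)–(4.13). [ConstantinFoiasNSE1988]
* M. Reed, B. Simon, *Methods of Modern Mathematical Physics I* (Academic Press, 1980), §VIII.3
  Proposition 1, Thm. VIII.2, Thm. VI.12–VI.13. [ReedSimonI1980]
* P. R. Halmos, *A Hilbert Space Problem Book*, 2nd ed. (Springer, 1982), Problems 61–63, 171.
-/

noncomputable section

open Filter
open scoped InnerProductSpace ENNReal Topology

namespace Literature.Analysis.FluidPDE

/-! ### The resolvent of a non-negative diagonal operator with compact resolvent -/

/-- **Resolvent `(1 + diag m)⁻¹` of a non-negative diagonal operator with divergent symbol.**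
Let `b` be a Hilbert basis of a real Hilbert space `H` and `m : ι → ℝ` a symbol with `0 ≤ m i`
and `m i → ∞` along the cofinite filter.  Then there is a bounded operator `R : H →L[ℝ] H`
(namely `b.diagonalCLM ((1 + m)⁻¹)`, the diagonal operator with the bounded symbol
`(1 + m i)⁻¹ ∈ (0, 1]`) which is injective, of norm `≤ 1`, self-adjoint and compact, maps `H`
into the maximal domain of `b.diagonalPMap m`, and inverts `1 + b.diagonalPMap m` on both sides:
`R v + diag(m) (R v) = v` for all `v ∈ H` and `R (v + diag(m) v) = v` for all `v ∈ D(diag m)`.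
(Reed–Simon I, §VIII.3 Proposition 1 with Thm. VIII.2: the resolvent of the self-adjoint
multiplication operator by `m` is multiplication by `(1 + m)⁻¹`; compactness since
`(1 + m i)⁻¹ → 0`, Thm. VI.12–VI.13 / Halmos Problem 171; norm and adjoint of a diagonal
operator, Halmos Problems 61–63.) [cite: ReedSimonI1980, §VIII.3 Proposition 1, Thm. VIII.2] -/
theorem exists_resolvent_diagonalPMap {ι H : Type*} [NormedAddCommGroup H]
    [InnerProductSpace ℝ H] [CompleteSpace H] (b : HilbertBasis ι ℝ H) {m : ι → ℝ}
    (hpos : ∀ i, 0 ≤ m i) (htend : Tendsto m cofinite atTop) :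
    ∃ R : H →L[ℝ] H, Function.Injective R ∧ ‖R‖ ≤ 1 ∧ IsSelfAdjoint R ∧ IsCompactOperator R ∧
      (∀ v : H, ∃ hv : R v ∈ (b.diagonalPMap m).domain, R v + b.diagonalPMap m ⟨R v, hv⟩ = v) ∧
      (∀ (v : H) (hv : v ∈ (b.diagonalPMap m).domain), R (v + b.diagonalPMap m ⟨v, hv⟩) = v) := by
  -- the symbol `r i = (1 + m i)⁻¹ ∈ (0, 1]`
  have hm1 : ∀ i, 0 < 1 + m i := fun i => add_pos_of_pos_of_nonneg one_pos (hpos i)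
  have hr0 : ∀ i, 0 < (1 + m i)⁻¹ := fun i => inv_pos.2 (hm1 i)
  have hr1 : ∀ i, ‖(1 + m i)⁻¹‖ ≤ 1 := fun i => by
    rw [Real.norm_of_nonneg (hr0 i).le]
    exact inv_le_one_of_one_le₀ (le_add_of_nonneg_right (hpos i))
  have hrmem : Memℓp (fun i => (1 + m i)⁻¹) ∞ :=
    memℓp_infty ⟨1, by rintro _ ⟨i, rfl⟩; exact hr1 i⟩
  obtain ⟨r, hr⟩ : ∃ r : lp (fun _ : ι => ℝ) ∞, ∀ i, r i = (1 + m i)⁻¹ :=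
    ⟨⟨fun i => (1 + m i)⁻¹, hrmem⟩, fun _ => rfl⟩
  -- the symbol `m i * r i ∈ [0, 1)` of `diag(m) ∘ R`
  have hmr : Memℓp (fun i => m i * (1 + m i)⁻¹) ∞ := by
    refine memℓp_infty ⟨1, ?_⟩
    rintro _ ⟨i, rfl⟩
    dsimp only
    rw [Real.norm_of_nonneg (mul_nonneg (hpos i) (hr0 i).le), ← div_eq_mul_inv,
      div_le_one (hm1 i)]
    exact le_add_of_nonneg_left zero_le_one
  -- coordinates of `R`
  have hcoord : ∀ (v : H) (i : ι), b.repr (b.diagonalCLM r v) i = (1 + m i)⁻¹ * b.repr v i :=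
    fun v i => by rw [b.diagonalCLM_apply_repr, hr]
  -- `R v ∈ D(diag m)`
  have hdom : ∀ v : H, b.diagonalCLM r v ∈ (b.diagonalPMap m).domain := fun v => by
    rw [HilbertBasis.diagonalPMap_domain, HilbertBasis.mem_diagonalDomain_iff]
    have h := hmr.infty_mul_left (lp.memℓp (b.repr v))
    refine (congrArg (Memℓp · 2) (funext fun i => ?_)).mp h
    dsimp only
    rw [hcoord, mul_assoc]
  refine ⟨b.diagonalCLM r, ?_, ?_, ?_, ?_, fun v => ⟨hdom v, ?_⟩, fun v hv => ?_⟩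
  · -- injective: the symbol does not vanish
    intro x y hxy
    apply b.repr.injective
    ext i
    have h := congrArg (fun z => b.repr z i) hxy
    simp only [hcoord] at h
    exact mul_left_cancel₀ (hr0 i).ne' h
  · -- `‖R‖ ≤ ‖r‖_∞ ≤ 1`
    refine (b.norm_diagonalCLM_le r).trans (lp.norm_le_of_forall_le zero_le_one fun i => ?_)
    rw [hr]
    exact hr1 i
  · -- self-adjoint: the symbol is real
    have hstar : star r = r := lp.ext (funext fun i => star_trivial (r i))
    rw [IsSelfAdjoint, ContinuousLinearMap.star_eq_adjoint, b.adjoint_diagonalCLM, hstar]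
  · -- compact: the symbol tends to zero
    refine b.isCompactOperator_diagonalCLM_of_tendsto_zero r ?_
    have h : Tendsto (fun i => (1 + m i)⁻¹) cofinite (𝓝 0) :=
      (tendsto_atTop_add_const_left _ 1 htend).inv_tendsto_atTop
    refine (tendsto_zero_iff_norm_tendsto_zero.mp h).congr fun i => ?_
    rw [hr]
  · -- `R v + diag(m) (R v) = v`, coefficientwise `(1 + m i) (1 + m i)⁻¹ c = c`
    apply b.repr.injective
    ext i
    rw [map_add, lp.coeFn_add, Pi.add_apply, HilbertBasis.repr_diagonalPMap_apply]
    change b.repr (b.diagonalCLM r v) i + m i * b.repr (b.diagonalCLM r v) i = b.repr v i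
    rw [hcoord]
    calc (1 + m i)⁻¹ * b.repr v i + m i * ((1 + m i)⁻¹ * b.repr v i)
        = (1 + m i) * (1 + m i)⁻¹ * b.repr v i := by ring
      _ = b.repr v i := by rw [mul_inv_cancel₀ (hm1 i).ne', one_mul]
  · -- `R (v + diag(m) v) = v`, coefficientwise `(1 + m i)⁻¹ (1 + m i) c = c`
    apply b.repr.injective
    ext i
    rw [hcoord, map_add, lp.coeFn_add, Pi.add_apply, HilbertBasis.repr_diagonalPMap_apply]
    change (1 + m i)⁻¹ * (b.repr v i + m i * b.repr v i) = b.repr v i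
    calc (1 + m i)⁻¹ * (b.repr v i + m i * b.repr v i)
        = (1 + m i)⁻¹ * (1 + m i) * b.repr v i := by ring
      _ = b.repr v i := by rw [inv_mul_cancel₀ (hm1 i).ne', one_mul]

/-! ### The Stokes resolvent on the torus -/

namespace Torus

/-- **The Stokes resolvent `(1 + A)⁻¹` on the energy space of the flat torus.**  For the Stokes
operator `A = Torus.stokesOperatorH d` on `H = Torus.energySpace d` (mean-zero solenoidal
`L²` vector fields on `T^d`) there is a bounded operator `R : H →L[ℝ] H` — the resolvent
`(1 + A)⁻¹`, diagonal with symbol `(1 + 4π²|k|²)⁻¹` in the Stokes eigenbasis — which is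
injective, of norm `≤ 1`, self-adjoint and compact, maps `H` into `D(A)`, and satisfies
`R v + A (R v) = v` for every `v ∈ H` and `R (v + A v) = v` for every `v ∈ D(A)`; i.e. `1 + A`
is a bijection `D(A) → H` with compact self-adjoint contractive inverse (Constantin–Foias 1988,
Ch. 4, (4.4)–(4.7) and (4.11)–(4.13): `A` is a positive self-adjoint operator with compact
inverse, `A w_j = λ_j w_j`, `0 < λ_1 ≤ λ_2 ≤ ⋯ → ∞`; Temam 1977, Ch. I §2.6).  Proof: the tree's
eigenbasis `exists_hilbertBasis_stokes_holds` (`A = b.diagonalPMap m`, `0 < m i → ∞`) and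
`exists_resolvent_diagonalPMap`. [cite: ConstantinFoiasNSE1988, Ch. 4 (4.4)–(4.7), (4.11)–(4.13)] -/
theorem exists_stokesResolvent (d : Type*) [Fintype d] [DecidableEq d] :
    ∃ R : FunctionSpaces.Torus.energySpace d →L[ℝ] FunctionSpaces.Torus.energySpace d,
      Function.Injective R ∧ ‖R‖ ≤ 1 ∧ IsSelfAdjoint R ∧ IsCompactOperator R ∧
      (∀ v : FunctionSpaces.Torus.energySpace d, ∃ hv : R v ∈ (stokesOperatorH d).domain,
        R v + stokesOperatorH d ⟨R v, hv⟩ = v) ∧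
      (∀ (v : FunctionSpaces.Torus.energySpace d) (hv : v ∈ (stokesOperatorH d).domain),
        R (v + stokesOperatorH d ⟨v, hv⟩) = v) := by
  obtain ⟨ι, b, m, -, hpos, htend, hA, -⟩ := exists_hilbertBasis_stokes_holds (d := d)
  rw [hA]
  exact exists_resolvent_diagonalPMap b (fun i => (hpos i).le) htend

end Torus

end Literature.Analysis.FluidPDE
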